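import Summits.QuantumFields.YangMills.Theorems.BalabanUVNodesN06SectBStepUParKnit
import Literature.MathematicalPhysics.QuantumFieldTheory.Balaban1983to89.B9SectBCodedClassKnitYC
import Literature.MathematicalPhysics.QuantumFieldTheory.Balaban1983to89.B9Eq358KnitTransporterVariationY

/-!
# Balaban UV-stability nodes, N06 [B9] Sect. B — «K2-G-HCLASS»: THE KNIT CODED CLASS CONTAINS THE RECORD's (3.37) PAIRS OVER REGULAR BASES — `hclass` of the coding
# `codingYx P G x (C37KY …) C38` INHABITED for a member family (`𝔸 = M_N(ℂ)`, `G ≤ U(N)` averaging-closed), the two displayed laws discharged by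
# dag-n06-l's (K1) `parVar337Y_parKnitY` and dag-n06-c's `parMemY_parKnitY`

[B9] = T. Bałaban, *Propagators for lattice gauge theories in a background field*, Commun. Math. Phys. **99** (1985) 389–434 [`Balaban1985BackgroundPropagators`];
[B8] = T. Bałaban, *Averaging operations for lattice gauge theories*, Commun. Math. Phys. **98** (1985) 17–51 [`Balaban1985Averaging`].

statement-level skeleton of published theorems with citation tags; proofs where landed; nothing here is a claim about the Yang–Mills mass gap

THE PRINT.  (3.35)–(3.37) p. 396 (the classes of the pair `(U, U′)`); p. 401 ∕ (3.58) p. 402 (the variation of the averaging's transporters, [B8]'s composite contours (3.19) p. 393);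
Thm 3.4 p. 400.

WHAT (seat dag-n06-c gen 26).  `B9SectBCodedClassKnitYC.hclass_C37KY_onC` (the class hypothesis of the knit coding over the class-parametric carrier `bg9YC 𝕄 G P x`, GIVEN the two
laws `ParVar337Y ∕ ParMemY` at `parKnitY`) with BOTH laws DISCHARGED: `ParVar337Y … (parKnitY i) ((bg9KP …).Reg335 c₀) (154(d+1)) αK aK` := dag-n06-l's
`B9Eq358KnitTransporterVariationY.parVar337Y_parKnitY` ((K1), [B9] p. 401 at the knit, ✓) and `ParMemY … (parKnitY i) ((bg9KP …).Reg335 c₀) aK` := `N06SectBStepUParKnit.parMemY_parKnitY`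
(dag-n06-l's `parKnitY_mem_of_reg335P`, ✓).  RESULT ★★★ `hclass_C37KY_knit`: for a member family `f`, sections `ιB`, ANY class-parametric `P` with the regime bridge `hRP` (coded class
⟹ local class `(bg9KP …).Reg335 c₀`, `c₀ ≦ 10`), any `R` read from the coded class (`hR`), and the x-free numerics (`α₀′` window with `C₀α₀′ ≦ 1∕3`, `4α₀′ ≦ c₂′`, `α₀′ ≦ α_Q`;
`K_pl(a)·L⁴ < α₀′` on `a ≦ aK`; [B8] Prop. 7's window `αK` with `hsmall ∕ hc₃ ∕ hsm`; a cap `αcap ≦ min(1∕4, αK)` with `154(d+1)·αcap ≦ 1∕2`, `L⁴αcap ≦ β₀`): every `U′` of the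
record's class (3.37) at `0 < α₁ ≦ αcap` over a base in the coded class (3.35) above `max (2(d+1)+1) MK ≦ M`, `M·α₀ ≦ aK`, has its code in
`C37KY G (f j) (ιB j) (R j) (4(d+1)e^{3(d+1)/2}) (4·154(d+1)) MK aK β₀` at exponent `L⁴α₁` — the knit class is NON-VACUOUS AT THE RECORD exactly where print's pairs live.

HONEST SCOPE.  Composition of landed theorems; conditional on the x-free numerics and the regime bridge; count-neutral; NOT the discharge of any N06 obligation; nothing
continuum ∕ OS ∕ mass gap ∕ Clay.  Cell `pub-ymgap` (HUMAN RULING D-0062), Track A node N06 [B9], 2026-08-30.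
-/

noncomputable section

namespace Summit.QuantumFields.YangMills.BalabanUVNodes.N06SectBClassKnitHclass

open scoped Matrix Matrix.Norms.L2Operator
open Literature.MathematicalPhysics.QuantumFieldTheory.Balaban1983to89
open Literature.MathematicalPhysics.QuantumFieldTheory.Balaban1983to89.Node00 (SiteY BlkY IBondY CfgY)
open Literature.MathematicalPhysics.QuantumFieldTheory.Balaban1983to89.B6Ineq2142KLevelV1 (β)
open Literature.MathematicalPhysics.QuantumFieldTheory.Balaban1983to89.B6KLevelCensusIndexV1 (KIdx kGeo)
open Literature.MathematicalPhysics.QuantumFieldTheory.Balaban1983to89.B9PinMembersKLevelV1 (MemberY geo9Y)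
open Literature.MathematicalPhysics.QuantumFieldTheory.Balaban1983to89.B9BackgroundsKLevelV1P (bg9KP)
open Literature.MathematicalPhysics.QuantumFieldTheory.Balaban1983to89.B9SectBCodedClassR (RegExtraY bg9YC)
open Literature.MathematicalPhysics.QuantumFieldTheory.Balaban1983to89.B9Eq360DeltaPrimeAY (AfldY)
open Literature.MathematicalPhysics.QuantumFieldTheory.Balaban1983to89.B9SectBGpFrameCodedYR (codingYx)
open Literature.MathematicalPhysics.QuantumFieldTheory.Balaban1983to89.B9SectBCodedClassKnitY (C37KY)
open Literature.MathematicalPhysics.QuantumFieldTheory.Balaban1983to89.B9SectBCodedClassKnitYC (hclass_C37KY_onC)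
open Literature.MathematicalPhysics.QuantumFieldTheory.Balaban1983to89.B7Prop2Explicit (unitaryUnits AvgClosed C0 c2')
open Literature.MathematicalPhysics.QuantumFieldTheory.Balaban1983to89.B7Prop3Flat (c3)
open Literature.MathematicalPhysics.QuantumFieldTheory.Balaban1983to89.B9Eq316AveragingTransposeZd (alphaQ)
open Literature.MathematicalPhysics.QuantumFieldTheory.Balaban1983to89.B9C2FormBoxRegimeY (Kpl)
open Literature.MathematicalPhysics.QuantumFieldTheory.Balaban1983to89.B9Eq358KnitTransporterVariationY (parVar337Y_parKnitY)
open Summit.QuantumFields.YangMills.BalabanUVNodes.N06SectBStepUParKnit (norm_le_one_of_le_unitaryUnits parMemY_parKnitY)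

variable {d ℓ : ℕ} {hd : 1 ≤ d + 1} {hL : Odd (ℓ + 1) ∧ 1 < ℓ + 1} {b₀ b₁ : ℝ}
variable {N : ℕ} [Nonempty (Fin N)]
variable {Mstar : ℕ} (P : RegExtraY d ℓ hd hL b₀ b₁ Mstar (Matrix (Fin N) (Fin N) ℂ)) {J : Type} (f : J → MemberY d ℓ hd hL b₀ b₁ Mstar)
  (c35 : ℝ) (G : Subgroup (Matrix (Fin N) (Fin N) ℂ)ˣ) (ιB : ∀ j : J, BlkY (f j).toKIdx → IBondY (f j).toKIdx)
  (C38 : ∀ j : J, ℝ → CfgY (Matrix (Fin N) (Fin N) ℂ) (f j).toKIdx → AfldY (Matrix (Fin N) (Fin N) ℂ) (f j).toKIdx → Prop)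
  (R : ∀ j : J, ℝ → CfgY (Matrix (Fin N) (Fin N) ℂ) (f j).toKIdx → Prop) (MK aK β₀ : ℝ)

/-- ★★★ **THE KNIT CODED CLASS CONTAINS THE RECORD's (3.37) PAIRS OVER REGULAR BASES** — `hclass_C37KY_onC` with the two knit laws discharged (`parVar337Y_parKnitY`, dag-n06-l (K1);
`parMemY_parKnitY`, dag-n06-c), constants `Cq = 4(d+1)e^{3(d+1)/2}`, `CqK = 4·154(d+1)`; displayed: the numerics windows, the regime bridge `hRP`, the reading `hR` of the class's
regularity predicate, `hGa hGU`. [cite: Balaban1985BackgroundPropagators, (3.37) p.396, (3.35) p.396, p.401, (3.58) p.402, (3.19) p.393, Thm 3.4 p.400; Balaban1985Averaging, Prop. 2 p.26, Prop. 7 p.43] -/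
theorem hclass_C37KY_knit (hι : ∀ (j : J) (s : BlkY (f j).toKIdx), β (f j).toKIdx.hN (f j).toKIdx.D (f j).toKIdx.hk (ιB j s) = s)
    (hGa : AvgClosed (d + 1) (ℓ + 1) G) (hGU : G ≤ unitaryUnits (Matrix (Fin N) (Fin N) ℂ)) {c₀ : ℝ} (hc : c₀ ≤ 10)
    (hRP : ∀ (j : J) (α₀ : ℝ) (U : CfgY (Matrix (Fin N) (Fin N) ℂ) (f j).toKIdx),
      (bg9YC (Matrix (Fin N) (Fin N) ℂ) G P (f j)).Reg335 c35 α₀ U → (bg9KP (Matrix (Fin N) (Fin N) ℂ) G (f j).toKIdx).Reg335 c₀ α₀ U)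
    (hR : ∀ (j : J) (α₀ : ℝ) (U : CfgY (Matrix (Fin N) (Fin N) ℂ) (f j).toKIdx), (bg9YC (Matrix (Fin N) (Fin N) ℂ) G P (f j)).Reg335 c35 α₀ U → R j α₀ U)
    {α₀' : ℝ} (hα' : 0 < α₀') (hα3 : C0 (d + 1) * α₀' ≤ 1 / 3) (hα4 : 4 * α₀' ≤ c2' (d + 1) (ℓ + 1)) (hαQ : α₀' ≤ alphaQ (d + 1) (ℓ + 1))
    (hKpl : ∀ (j : J) (a : ℝ), 0 ≤ a → a ≤ aK → Kpl (f j).toKIdx a * (kGeo (f j).toKIdx).L ^ 4 < α₀')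
    {αK : ℝ} (hsmall : Real.exp (4 * (800 * (((d + 1 : ℕ) : ℝ) + 1) ^ 2 * (((d + 1 : ℕ) : ℝ) + 4)) * α₀')
      * (1 + 8 * (131072 * (((d + 1 : ℕ) : ℝ) + 1) ^ 2) * αK) ≤ 2)
    (hc₃ : 2 * αK ≤ c3 (d + 1) (ℓ + 1)) (hsm : 4096 * ((d + 1 : ℕ) : ℝ) * αK ≤ 1)
    {αcap : ℝ} (hcap4 : αcap ≤ 1 / 4) (hcapK : αcap ≤ αK) (hcapC : (154 * ((d : ℝ) + 1)) * αcap ≤ 1 / 2) (hcapβ : (((ℓ : ℝ) + 1) ^ 4) * αcap ≤ β₀) :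
    ∀ (j : J) (α₀ α₁ : ℝ) (U U' : (bg9YC (Matrix (Fin N) (Fin N) ℂ) G P (f j)).Cfg), max (2 * ((d : ℝ) + 1) + 1) MK ≤ (geo9Y (f j)).M → 0 < α₀ →
      (geo9Y (f j)).M * α₀ ≤ aK → (bg9YC (Matrix (Fin N) (Fin N) ℂ) G P (f j)).Reg335 c35 α₀ U → 0 < α₁ → α₁ ≤ αcap →
      (bg9YC (Matrix (Fin N) (Fin N) ℂ) G P (f j)).Cplx337 α₁ U U' →
      ∃ a : (codingYx P G (f j) (C37KY G (f j) (ιB j) (R j) (4 * ((d : ℝ) + 1) * Real.exp (3 * (((d : ℝ) + 1) / 2))) (4 * (154 * ((d : ℝ) + 1))) MK aK β₀) (C38 j)).A,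
        (codingYx P G (f j) (C37KY G (f j) (ιB j) (R j) (4 * ((d : ℝ) + 1) * Real.exp (3 * (((d : ℝ) + 1) / 2))) (4 * (154 * ((d : ℝ) + 1))) MK aK β₀) (C38 j)).decA a = U' ∧
        (codingYx P G (f j) (C37KY G (f j) (ιB j) (R j) (4 * ((d : ℝ) + 1) * Real.exp (3 * (((d : ℝ) + 1) / 2))) (4 * (154 * ((d : ℝ) + 1))) MK aK β₀) (C38 j)).C37
          ((((ℓ : ℝ) + 1) ^ 4) * α₁) U a := by
  have hCp : (0 : ℝ) ≤ 154 * ((d : ℝ) + 1) := by positivity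
  have hM : ∀ j, 0 ≤ (kGeo (f j).toKIdx).M := fun j => by
    show (0 : ℝ) ≤ ((ℓ + 1 : ℕ) : ℝ) * ((f j).toKIdx.Mh : ℝ); positivity
  exact hclass_C37KY_onC P f G ιB C38 R (fun j α₀ U => (bg9KP (Matrix (Fin N) (Fin N) ℂ) G (f j).toKIdx).Reg335 c₀ α₀ U) hι
    (norm_le_one_of_le_unitaryUnits G hGU) c35 hCp
    (fun j => parVar337Y_parKnitY (f j).toKIdx hGU hc hα' hα3 hα4 (hKpl j) hsmall hc₃ hsm)
    (fun j => parMemY_parKnitY G (f j).toKIdx hGa hGU (hM j) hc hα' hαQ (hKpl j)) hR hRP hcap4 hcapK hcapC hcapβ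

end Summit.QuantumFields.YangMills.BalabanUVNodes.N06SectBClassKnitHclass

end
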